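import Summits.QuantumFields.YangMills.Theorems.SwapVirialDeficitSwapRingMeanActionFixedL
import Summits.QuantumFields.YangMills.Theorems.SwapVirialDeficitLaplaceAbelianLimit
import HarnessLib

/-!
# The σ-glued ring at fixed `L`: mean action and stiffness from the principal small-ball law in LIMIT FORM
# (free-hands support of ⟨stmt-QuantumFields-24197⟩ `SwapVirialDeficit.SwapGluedStiffness`; the interface the massive-mode rung should aim at)

w2 g55's fixed-`L` rows ✓`swap_meanAction_fixedL_of_principalLaw` ∕ ✓`swap_stiffness_fixedL_of_principalLaw` consume the principal σ-sector
state density with a POWER RATE, `|μ_L{F^S_{000} ≤ t}/(v·t^N) − 1| ≤ κ·t^θ` on `(0, t₀]` (`N = 9L⁴ − 1`).  At fixed `L` the rate is not needed: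
this file derives the same mean-action asymptotics from the LIMIT alone,

  `hlim : Tendsto (fun s => μ_L{F^S_{000} ≤ s} / s^N) (𝓝[>] 0) (𝓝 v)`, `0 < v`,

which is the currency in which the cell's blow-up ∕ dominator ∕ dominated-convergence proofs deliver small-ball laws (w3 g63's
✓`ZeroModeSigma.sigmaBall_smallBall_limit`, fcl-p3 g44's ✓`…FourSmallBallLogLimit`): a joint blow-up of the followers (scale `√u`) and of the
leaders (w3's cone) would prove exactly `hlim` for the full ring deficit, and then everything below is unconditional at that `L`.

* §0 `principalLimit_of_principalLaw` — the rate form implies the limit form (so this file generalises the rate-form rows).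
* §1 `tendsto_rpow_mul_principal_laplace` — `b^N·∫e^{−bF^S_{000}}dμ_L → v·Γ(N+1)` (✓`Abelian.tendsto_laplace_abelian`);
  `tendsto_rpow_mul_nonprincipal_laplace` — the three other classes with `z 0 = 0` have `b^N·∫e^{−bF^S_z}dμ_L → 0`
  (✓`nonprincipal_laplace_eventually`: they are `O(b^{−N−1/2})`).
* §2 ★★ `tendsto_logTwistTrace_sub` — `log Z^S(L,b,2L) − (12bL⁴ − N·log b) → log(v·N!/4)` (pairing ✓`twistTrace_eq_quarter_sum_filter`).
* §3 ★★★ `tendsto_meanAction_of_principalLimit` — `b·(log Z^S)′(b) − 12bL⁴ → −(9L⁴ − 1)`: Griffiths' convex transport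
  ✓`ConvexTransport.window_bound` with `η → 0` (convexity ✓`logTwistTraceConvex`, smoothness ✓`swapVirialDeficit_ringTraceSmooth_proof`).
* §4 ★★ `swap_stiffness_fixedL_of_principalLimit` — for every `ε > 0`, eventually
  `12bL⁴ − 9L⁴ + 1 − ε ≤ b·(log Z^S)′(b) ≤ 12bL⁴ − 9L⁴ + 3/2 − (1/2 − ε)`: the fixed-`L` instance of `SwapGluedStiffness` with ANY `c < 1/2`;
  `swap_meanActionGap_fixedL_of_limits` — with the periodic mean action in limit form as a second hypothesis, the fixed-`L` relative gap `≤ −(1/2 − 2ε)`.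

HONEST LABEL: fixed-`L` bookkeeping (real analysis on landed rows); the principal small-ball LIMIT law itself (massive-mode rung) is NOT proved here;
⟨24197⟩ ∕ ⟨24194⟩ ∕ ⟨24196⟩ ∕ ⟨24497⟩ (window-uniform) stay OPEN; the Yang–Mills mass gap is NOT proved; no summit is proved by a line.
Seat ym-line-fcl-p3 g45 (cell ym-idea-1, free hands; item of record ⟨24085⟩ aside, untouched), `--supports stmt-QuantumFields-24197`.
THEOREMS ONLY (0 `def`, 0 `sorry`), standard axioms.  References: [cite: Griffiths1964]; [cite: tHooft1979]; [cite: Luscher1983, §2]; [folklore]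
(Feller XIII.5 for the Abelian step).
-/

set_option autoImplicit false

noncomputable section

open MeasureTheory Set Filter Topology
open scoped BigOperators ENNReal Nat
open Literature.MathematicalPhysics.QuantumFieldTheory hiding SU2
open Literature.MathematicalPhysics.QuantumLattice

namespace Summit.QuantumFields.YangMills.Theorems.SwapVirialDeficit.SwapRing

open Summit.QuantumFields.YangMills.Theorems.FemtoTransferGap
open Summit.QuantumFields.YangMills.Theorems.FemtoTransferGap.TT
open Summit.QuantumFields.YangMills.Theorems.VirialFluxGap.RingDeficit
open Summit.QuantumFields.YangMills.Theorems.FemtoTransferGap.TT.SectorSmooth (logTwistTraceConvex)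
open Summit.QuantumFields.YangMills.Theorems.VirialFluxGap.ConvexTransport (window_bound)
open Summit.QuantumFields.YangMills.Theorems.SwapVirialDeficit.Abelian (tendsto_laplace_abelian)

variable {L : ℕ} [NeZero L]

/-! ## §0 The rate form implies the limit form -/

/-- The principal sharp law with a power rate (hypothesis of ✓`swap_meanAction_fixedL_of_principalLaw`) implies the LIMIT form
`μ_L{F^S_{000} ≤ s}/s^{9L⁴−1} → v` as `s → 0⁺`: `|m/s^N − v| = v·|m/(v s^N) − 1| ≤ v·κ·s^θ → 0`. [folklore] -/
theorem principalLimit_of_principalLaw {v κ θ t₀ : ℝ} (hv : 0 < v) (hθ : 0 < θ) (ht₀ : 0 < t₀)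
    (hvol : ∀ t : ℝ, 0 < t → t ≤ t₀ →
      |(ringMeasure L).real {P | swapRingDeficit L (fun _ => false) P ≤ t} / (v * t ^ (9 * L ^ 4 - 1)) - 1| ≤ κ * t ^ θ) :
    Tendsto (fun s : ℝ => (ringMeasure L).real {P | swapRingDeficit L (fun _ => false) P ≤ s} / s ^ (9 * L ^ 4 - 1))
      (𝓝[>] 0) (𝓝 v) := by
  set m : ℝ → ℝ := fun s => (ringMeasure L).real {P | swapRingDeficit L (fun _ => false) P ≤ s} with hm
  -- `v κ s^θ → 0` along `s → 0⁺`
  have hpow : Tendsto (fun s : ℝ => v * κ * s ^ θ) (𝓝[>] 0) (𝓝 0) := by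
    have h1 : Tendsto (fun s : ℝ => s ^ θ) (𝓝[>] 0) (𝓝 0) := by
      have h := ((Real.continuous_rpow_const hθ.le).tendsto (0 : ℝ)).mono_left (nhdsWithin_le_nhds (s := Ioi (0 : ℝ)))
      rwa [Real.zero_rpow hθ.ne'] at h
    have h2 := h1.const_mul (v * κ)
    rwa [mul_zero] at h2
  have hdiff : Tendsto (fun s : ℝ => m s / s ^ (9 * L ^ 4 - 1) - v) (𝓝[>] 0) (𝓝 0) := by
    refine squeeze_zero_norm' ?_ hpow
    filter_upwards [Ioc_mem_nhdsGT ht₀] with s hs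
    have hs0 : 0 < s := hs.1
    have hsN : 0 < s ^ (9 * L ^ 4 - 1) := pow_pos hs0 _
    have hid : m s / s ^ (9 * L ^ 4 - 1) - v = v * (m s / (v * s ^ (9 * L ^ 4 - 1)) - 1) := by
      field_simp
    rw [Real.norm_eq_abs, hid, abs_mul, abs_of_pos hv, mul_assoc]
    exact mul_le_mul_of_nonneg_left (hvol s hs0 hs.2) hv.le
  have h := hdiff.add_const v
  simpa only [sub_add_cancel, zero_add] using h

/-! ## §1 The sector Laplace integrals against `b^N` -/

/-- ★ **Principal class**: from the small-ball LIMIT `μ_L{F^S_{000} ≤ s}/s^N → v` (`N = 9L⁴ − 1`), `b^N·∫e^{−bF^S_{000}}dμ_L → v·Γ(N+1)` as `b → ∞`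
(✓`Abelian.tendsto_laplace_abelian` on the probability space `(ring histories, μ_L)`). [folklore] -/
theorem tendsto_rpow_mul_principal_laplace {v : ℝ}
    (hlim : Tendsto (fun s : ℝ => (ringMeasure L).real {P | swapRingDeficit L (fun _ => false) P ≤ s} / s ^ (9 * L ^ 4 - 1))
      (𝓝[>] 0) (𝓝 v)) :
    Tendsto (fun b : ℝ => b ^ (((9 * L ^ 4 - 1 : ℕ) : ℝ)) *
        ∫ P, Real.exp (-(b * swapRingDeficit L (fun _ => false) P)) ∂(ringMeasure L)) atTop
      (𝓝 (v * Real.Gamma ((((9 * L ^ 4 - 1 : ℕ) : ℝ)) + 1))) := by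
  haveI := isProbabilityMeasure_ringMeasure (L := L)
  have hL1 : 1 ≤ L := NeZero.one_le
  have h9 : 1 ≤ 9 * L ^ 4 := by have := Nat.one_le_pow 4 L hL1; omega
  have hα : (0 : ℝ) < ((9 * L ^ 4 - 1 : ℕ) : ℝ) := by
    have h8 : 8 ≤ 9 * L ^ 4 - 1 := by have := Nat.one_le_pow 4 L hL1; omega
    exact_mod_cast (show 0 < 9 * L ^ 4 - 1 by omega)
  have hlim' : Tendsto (fun s : ℝ => ((ringMeasure L) {P | swapRingDeficit L (fun _ => false) P ≤ s}).toReal /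
      s ^ (((9 * L ^ 4 - 1 : ℕ) : ℝ))) (𝓝[>] 0) (𝓝 v) := by
    refine hlim.congr' (Eventually.of_forall fun s => ?_)
    simp only [measureReal_def, Real.rpow_natCast]
  exact tendsto_laplace_abelian (ringMeasure L) (measurable_swapRingDeficit _) (swapRingDeficit_nonneg (L := L) _) hα hlim'

/-- ★ **Non-principal classes**: for `z` in a minus class (`z 2 = 1`) or an odd class (`z 0 ≠ z 1`), `b^N·∫e^{−bF^S_z}dμ_L → 0` —
they are `O(b^{−N−1/2})` (✓`nonprincipal_laplace_eventually`). [cite: tHooft1979] [cite: Luscher1983, §2] -/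
theorem tendsto_rpow_mul_nonprincipal_laplace (z : Fin 3 → Bool) (hz : z 2 = true ∨ z 0 ≠ z 1) :
    Tendsto (fun b : ℝ => b ^ (((9 * L ^ 4 - 1 : ℕ) : ℝ)) *
        ∫ P, Real.exp (-(b * swapRingDeficit L z P)) ∂(ringMeasure L)) atTop (𝓝 0) := by
  obtain ⟨K, hK0, hK⟩ := nonprincipal_laplace_eventually (L := L) z
  set N : ℝ := ((9 * L ^ 4 - 1 : ℕ) : ℝ) with hN
  -- the majorant `K·b^{−1/2} → 0`
  have hmaj : Tendsto (fun b : ℝ => K * b ^ (-(1 / 2 : ℝ))) atTop (𝓝 0) := by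
    have h := (tendsto_rpow_neg_atTop (by norm_num : (0 : ℝ) < 1 / 2)).const_mul K
    rwa [mul_zero] at h
  refine squeeze_zero_norm' ?_ hmaj
  filter_upwards [hK, eventually_gt_atTop (0 : ℝ)] with b hb hb0
  have hI0 : 0 ≤ ∫ P, Real.exp (-(b * swapRingDeficit L z P)) ∂(ringMeasure L) := integral_nonneg fun P => (Real.exp_pos _).le
  have hbN : 0 < b ^ N := Real.rpow_pos_of_pos hb0 _
  rw [Real.norm_eq_abs, abs_of_nonneg (mul_nonneg hbN.le hI0)]
  calc b ^ N * ∫ P, Real.exp (-(b * swapRingDeficit L z P)) ∂(ringMeasure L) ≤ b ^ N * (K * b ^ (-(N + 1 / 2))) :=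
        mul_le_mul_of_nonneg_left (hb hz) hbN.le
    _ = K * b ^ (-(1 / 2 : ℝ)) := by
        have hsplit : b ^ (-(N + 1 / 2)) = b ^ (-N) * b ^ (-(1 / 2 : ℝ)) := by
          rw [show -(N + 1 / 2) = -N + -(1 / 2 : ℝ) by ring, Real.rpow_add hb0]
        rw [hsplit, ← mul_assoc, ← mul_assoc, mul_comm (b ^ N) K, mul_assoc K, ← Real.rpow_add hb0, add_neg_cancel,
          Real.rpow_zero, mul_one]

/-- ★ **The folded sector sum**: `b^N·Σ_{z 0 = 0} ∫e^{−bF^S_z}dμ_L → v·Γ(N+1)` (principal class + three vanishing classes,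
✓`minus_or_odd_of_mem_erase`). [cite: tHooft1979] [folklore] -/
theorem tendsto_rpow_mul_foldedSum {v : ℝ}
    (hlim : Tendsto (fun s : ℝ => (ringMeasure L).real {P | swapRingDeficit L (fun _ => false) P ≤ s} / s ^ (9 * L ^ 4 - 1))
      (𝓝[>] 0) (𝓝 v)) :
    Tendsto (fun b : ℝ => b ^ (((9 * L ^ 4 - 1 : ℕ) : ℝ)) *
        ∑ z ∈ (Finset.univ : Finset (Fin 3 → Bool)).filter (fun z => z 0 = false),
          ∫ P, Real.exp (-(b * swapRingDeficit L z P)) ∂(ringMeasure L)) atTop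
      (𝓝 (v * Real.Gamma ((((9 * L ^ 4 - 1 : ℕ) : ℝ)) + 1))) := by
  set S : Finset (Fin 3 → Bool) := (Finset.univ : Finset (Fin 3 → Bool)).filter (fun z => z 0 = false) with hS
  have hz₀ : (fun _ : Fin 3 => false) ∈ S := by simp [hS]
  set I : (Fin 3 → Bool) → ℝ → ℝ := fun z b => ∫ P, Real.exp (-(b * swapRingDeficit L z P)) ∂(ringMeasure L) with hI
  -- split off the principal class
  have hsplit : ∀ b : ℝ, b ^ (((9 * L ^ 4 - 1 : ℕ) : ℝ)) * ∑ z ∈ S, I z b =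
      b ^ (((9 * L ^ 4 - 1 : ℕ) : ℝ)) * I (fun _ => false) b +
        ∑ z ∈ S.erase (fun _ => false), b ^ (((9 * L ^ 4 - 1 : ℕ) : ℝ)) * I z b := by
    intro b
    rw [← Finset.add_sum_erase S (fun z => I z b) hz₀, mul_add, Finset.mul_sum]
  have hrest : Tendsto (fun b : ℝ => ∑ z ∈ S.erase (fun _ => false), b ^ (((9 * L ^ 4 - 1 : ℕ) : ℝ)) * I z b) atTop (𝓝 0) := by
    have h : Tendsto (fun b : ℝ => ∑ z ∈ S.erase (fun _ => false), b ^ (((9 * L ^ 4 - 1 : ℕ) : ℝ)) * I z b) atTop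
        (𝓝 (∑ z ∈ S.erase (fun _ => false), (0 : ℝ))) := by
      refine tendsto_finsetSum _ fun z hz => ?_
      exact tendsto_rpow_mul_nonprincipal_laplace (L := L) z (minus_or_odd_of_mem_erase hz)
    rwa [Finset.sum_const_zero] at h
  have hmain := (tendsto_rpow_mul_principal_laplace (L := L) hlim).add hrest
  rw [add_zero] at hmain
  refine hmain.congr fun b => ?_
  simp only [hI] at hsplit ⊢
  exact (hsplit b).symm

/-! ## §2 The logarithm of the σ-glued trace -/

/-- ★★ **`log Z^S(L,b,2L) − (12bL⁴ − N·log b) → log(v·N!/4)`** (`N = 9L⁴ − 1`) from the principal small-ball LIMIT: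
`Z^S = ¼·e^{12bL⁴}·Σ_{z 0 = 0} I_z` (✓`twistTrace_eq_quarter_sum_filter`) and `b^N·Σ I_z → v·Γ(N+1) = v·N! > 0`.
[cite: tHooft1979] [cite: Luscher1983, §2] [folklore] -/
theorem tendsto_logTwistTrace_sub {v : ℝ} (hv : 0 < v)
    (hlim : Tendsto (fun s : ℝ => (ringMeasure L).real {P | swapRingDeficit L (fun _ => false) P ≤ s} / s ^ (9 * L ^ 4 - 1))
      (𝓝[>] 0) (𝓝 v)) :
    Tendsto (fun b : ℝ => Real.log (TT.twistTrace L b (2 * L)) - (12 * b * (L : ℝ) ^ 4 - (9 * (L : ℝ) ^ 4 - 1) * Real.log b))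
      atTop (𝓝 (Real.log (v * ((9 * L ^ 4 - 1) ! : ℝ) / 4))) := by
  have hL1 : 1 ≤ L := NeZero.one_le
  have h9 : 1 ≤ 9 * L ^ 4 := by have := Nat.one_le_pow 4 L hL1; omega
  have hNcast : (((9 * L ^ 4 - 1 : ℕ) : ℝ)) = 9 * (L : ℝ) ^ 4 - 1 := by
    rw [Nat.cast_sub h9]; push_cast; ring
  set S : Finset (Fin 3 → Bool) := (Finset.univ : Finset (Fin 3 → Bool)).filter (fun z => z 0 = false) with hS
  set Fsum : ℝ → ℝ := fun b => ∑ z ∈ S, ∫ P, Real.exp (-(b * swapRingDeficit L z P)) ∂(ringMeasure L) with hFsum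
  -- the folded sum against `b^N` converges to `v·N! > 0`
  have hΓ : Real.Gamma ((((9 * L ^ 4 - 1 : ℕ) : ℝ)) + 1) = ((9 * L ^ 4 - 1) ! : ℝ) := Real.Gamma_nat_eq_factorial _
  have hfold : Tendsto (fun b : ℝ => b ^ (((9 * L ^ 4 - 1 : ℕ) : ℝ)) * Fsum b) atTop (𝓝 (v * ((9 * L ^ 4 - 1) ! : ℝ))) := by
    rw [← hΓ]; exact tendsto_rpow_mul_foldedSum (L := L) hlim
  have hpos : 0 < v * ((9 * L ^ 4 - 1) ! : ℝ) / 4 := by positivity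
  have hquarter : Tendsto (fun b : ℝ => (1 / 4 : ℝ) * (b ^ (((9 * L ^ 4 - 1 : ℕ) : ℝ)) * Fsum b)) atTop
      (𝓝 (v * ((9 * L ^ 4 - 1) ! : ℝ) / 4)) := by
    have h := hfold.const_mul (1 / 4 : ℝ)
    rw [show (1 / 4 : ℝ) * (v * ((9 * L ^ 4 - 1) ! : ℝ)) = v * ((9 * L ^ 4 - 1) ! : ℝ) / 4 by ring] at h
    exact h
  have hlog := hquarter.log hpos.ne'
  -- identify the two functions for `b > 0`
  refine hlog.congr' ?_
  filter_upwards [eventually_gt_atTop (0 : ℝ), hquarter.eventually (Ioi_mem_nhds hpos)] with b hb0 hqpos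
  have hqpos' : 0 < (1 / 4 : ℝ) * (b ^ (((9 * L ^ 4 - 1 : ℕ) : ℝ)) * Fsum b) := hqpos
  have hbN : 0 < b ^ (((9 * L ^ 4 - 1 : ℕ) : ℝ)) := Real.rpow_pos_of_pos hb0 _
  have hFpos : 0 < Fsum b := by
    by_cases h : Fsum b ≤ 0
    · exfalso
      have : (1 / 4 : ℝ) * (b ^ (((9 * L ^ 4 - 1 : ℕ) : ℝ)) * Fsum b) ≤ 0 := by
        have := mul_nonpos_iff.2 (Or.inl ⟨hbN.le, h⟩)
        linarith
      linarith
    · exact not_le.1 h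
  have hZ : TT.twistTrace L b (2 * L) = (1 / 4 : ℝ) * (Real.exp (12 * b * (L : ℝ) ^ 4) * Fsum b) := by
    rw [twistTrace_eq_quarter_sum_filter, ← Finset.mul_sum]
  have h14 : (1 / 4 : ℝ) ≠ 0 := by norm_num
  have hE : Real.exp (12 * b * (L : ℝ) ^ 4) ≠ 0 := (Real.exp_pos _).ne'
  rw [hZ, Real.log_mul h14 (mul_ne_zero hbN.ne' hFpos.ne'), Real.log_mul hbN.ne' hFpos.ne', Real.log_rpow hb0,
    Real.log_mul h14 (mul_ne_zero hE hFpos.ne'), Real.log_mul hE hFpos.ne', Real.log_exp, hNcast]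
  ring

/-! ## §3 The mean action from the limit law (Griffiths' convex transport with `η → 0`) -/

/-- ★★★ **`⟨β𝒜⟩_{Z^S} → 9L⁴ − 1` AT FIXED `L`, FROM THE PRINCIPAL SMALL-BALL LIMIT.**  If `μ_L{F^S_{000} ≤ s}/s^{9L⁴−1} → v > 0` as `s → 0⁺`,
then `b·(d/db) log Z^S(L,b,2L) − 12bL⁴ → −(9L⁴ − 1)` as `b → ∞`: the reduced function `f(x) = log Z^S(x) − 12L⁴x` is convex
(✓`logTwistTraceConvex`), differentiable (✓`swapVirialDeficit_ringTraceSmooth_proof`) and within `η` of `C − N·log x` on `[b/2, 2b]` for all large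
`b` (§2), for EVERY `η > 0`; ✓`ConvexTransport.window_bound` gives `|b·f′(b) + N| ≤ N·u + 4η/u` for any `u ∈ (0,1]`, and `u`, then `η`, are
chosen from `ε`. [cite: Griffiths1964] [cite: tHooft1979] [cite: Luscher1983, §2] -/
theorem tendsto_meanAction_of_principalLimit (L : ℕ) [NeZero L] {v : ℝ} (hv : 0 < v)
    (hlim : Tendsto (fun s : ℝ => (ringMeasure L).real {P | swapRingDeficit L (fun _ => false) P ≤ s} / s ^ (9 * L ^ 4 - 1))
      (𝓝[>] 0) (𝓝 v)) :
    Tendsto (fun b : ℝ => b * deriv (fun x : ℝ => Real.log (TT.twistTrace L x (2 * L))) b - 12 * b * (L : ℝ) ^ 4) atTop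
      (𝓝 (-(9 * (L : ℝ) ^ 4 - 1))) := by
  obtain ⟨_, hZdiff, hpos⟩ := swapVirialDeficit_ringTraceSmooth_proof L (2 * L)
  have hZpos : ∀ x : ℝ, 0 < TT.twistTrace L x (2 * L) := fun x => (hpos x).2
  have hL1 : (1 : ℝ) ≤ L := by exact_mod_cast NeZero.one_le
  set N : ℝ := 9 * (L : ℝ) ^ 4 - 1 with hN
  set D : ℝ := 2 * N with hD
  have hN8 : 8 ≤ N := by
    have : (1 : ℝ) ≤ (L : ℝ) ^ 4 := one_le_pow₀ hL1
    rw [hN]; linarith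
  have hD0 : 0 < D := by rw [hD]; linarith
  set C : ℝ := Real.log (v * ((9 * L ^ 4 - 1) ! : ℝ) / 4) with hC
  -- the reduced function `f = log Z^S − 12L⁴·x`
  set f : ℝ → ℝ := fun x => Real.log (TT.twistTrace L x (2 * L)) - 12 * (L : ℝ) ^ 4 * x with hf
  have hmodel : Tendsto (fun x : ℝ => f x + D / 2 * Real.log x - C) atTop (𝓝 0) := by
    have h := (tendsto_logTwistTrace_sub (L := L) hv hlim).sub_const C
    rw [sub_self] at h
    refine h.congr fun x => ?_
    rw [hf, hD, hN]; ring
  rw [Metric.tendsto_atTop]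
  intro ε hε
  -- choose `u ∈ (0,1]` with `D·u/2 ≤ ε/4`, then `η > 0` with `4η/u ≤ ε/4`
  set u : ℝ := min 1 (ε / (2 * D)) with hu
  have hu0 : 0 < u := lt_min one_pos (by positivity)
  have hu1 : u ≤ 1 := min_le_left _ _
  have huD : D * u / 2 ≤ ε / 4 := by
    have h1 : u ≤ ε / (2 * D) := min_le_right _ _
    have h2 : D * u ≤ D * (ε / (2 * D)) := mul_le_mul_of_nonneg_left h1 hD0.le
    rw [mul_div_assoc'] at h2
    have h3 : D * ε / (2 * D) = ε / 2 := by field_simp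
    rw [h3] at h2
    linarith
  set η : ℝ := ε * u / 16 with hη
  have hη0 : 0 < η := by positivity
  have hηu : 4 * η / u = ε / 4 := by rw [hη]; field_simp; ring
  -- the model holds within `η` beyond `x₀`
  have hev : ∀ᶠ x : ℝ in atTop, |f x + D / 2 * Real.log x - C| < η := by
    have h := (Metric.tendsto_nhds.1 hmodel) η hη0
    simpa only [dist_zero_right, Real.norm_eq_abs] using h
  obtain ⟨x₀, hx₀⟩ := hev.exists_forall_of_atTop
  refine ⟨max (2 * x₀) 2, fun b hb => ?_⟩
  have hb2 : 2 ≤ b := le_trans (le_max_right _ _) hb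
  have hb0 : 0 < b := by linarith
  have hbx : 2 * x₀ ≤ b := le_trans (le_max_left _ _) hb
  -- convexity and differentiability of `f`
  have hconv : ConvexOn ℝ (Set.Icc (b / 2) (2 * b)) f :=
    ((logTwistTraceConvex L (2 * L)).subset (Set.subset_univ _) (convex_Icc _ _)).sub
      (concaveOn_const_mul (12 * (L : ℝ) ^ 4) (by positivity) _ (convex_Icc _ _))
  have hdlog : DifferentiableAt ℝ (fun x : ℝ => Real.log (TT.twistTrace L x (2 * L))) b := (hZdiff b).log (hZpos b).ne'
  have hdlin : HasDerivAt (fun x : ℝ => 12 * (L : ℝ) ^ 4 * x) (12 * (L : ℝ) ^ 4) b := by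
    simpa using (hasDerivAt_id b).const_mul (12 * (L : ℝ) ^ 4)
  have hfd : HasDerivAt f (deriv (fun x : ℝ => Real.log (TT.twistTrace L x (2 * L))) b - 12 * (L : ℝ) ^ 4) b :=
    hdlog.hasDerivAt.sub hdlin
  have hdiff : DifferentiableAt ℝ f b := hfd.differentiableAt
  have hderiv : deriv f b = deriv (fun x : ℝ => Real.log (TT.twistTrace L x (2 * L))) b - 12 * (L : ℝ) ^ 4 := hfd.deriv
  -- the model on the window `[b/2, 2b]`
  have happrox : ∀ x ∈ Set.Icc (b / 2) (2 * b), |f x + D / 2 * Real.log x - C| ≤ η := by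
    intro x hx
    have hx1 : x₀ ≤ x := by linarith [hx.1]
    exact (hx₀ x hx1).le
  -- convex transport
  have hT := window_bound f D C η b hb0 hD0.le hη0.le hconv hdiff happrox u hu0 hu1
  rw [hderiv, hηu] at hT
  rw [Real.dist_eq]
  have hdev : b * deriv (fun x : ℝ => Real.log (TT.twistTrace L x (2 * L))) b - 12 * b * (L : ℝ) ^ 4 - -(9 * (L : ℝ) ^ 4 - 1) =
      b * (deriv (fun x : ℝ => Real.log (TT.twistTrace L x (2 * L))) b - 12 * (L : ℝ) ^ 4) + D / 2 := by
    rw [hD, hN]; ring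
  rw [hdev]
  calc |b * (deriv (fun x : ℝ => Real.log (TT.twistTrace L x (2 * L))) b - 12 * (L : ℝ) ^ 4) + D / 2| ≤ D * u / 2 + ε / 4 := hT
    _ ≤ ε / 4 + ε / 4 := by linarith
    _ < ε := by linarith

/-! ## §4 Fixed-`L` stiffness with any `c < 1/2`, and the relative gap in limit form -/

/-- ★★ **THE FIXED-`L` SWAP-GLUED STIFFNESS (and softness) with ANY `c < 1/2`, from the principal small-ball LIMIT**: for every `ε > 0` there is
`β₃` with `b·(log Z^S)′(b) ≤ 12bL⁴ − 9L⁴ + 3/2 − (1/2 − ε)` and `12bL⁴ − 9L⁴ + 1 − ε ≤ b·(log Z^S)′(b)` for all `b ≥ β₃` — the fixed-`L`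
instance of the crux inequality `SwapGluedStiffness` (whose content is window-uniformity), `c = 1/2 − ε`. [cite: Griffiths1964] [cite: tHooft1979] -/
theorem swap_stiffness_fixedL_of_principalLimit (L : ℕ) [NeZero L] {v : ℝ} (hv : 0 < v)
    (hlim : Tendsto (fun s : ℝ => (ringMeasure L).real {P | swapRingDeficit L (fun _ => false) P ≤ s} / s ^ (9 * L ^ 4 - 1))
      (𝓝[>] 0) (𝓝 v))
    {ε : ℝ} (hε : 0 < ε) :
    ∃ β₃ : ℝ, ∀ b : ℝ, β₃ ≤ b →
      b * deriv (fun x : ℝ => Real.log (TT.twistTrace L x (2 * L))) b ≤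
          12 * b * (L : ℝ) ^ 4 - 9 * (L : ℝ) ^ 4 + 3 / 2 - (1 / 2 - ε) ∧
      12 * b * (L : ℝ) ^ 4 - 9 * (L : ℝ) ^ 4 + 1 - ε ≤ b * deriv (fun x : ℝ => Real.log (TT.twistTrace L x (2 * L))) b := by
  have h := (Metric.tendsto_atTop.1 (tendsto_meanAction_of_principalLimit L hv hlim)) ε hε
  obtain ⟨β₃, hβ₃⟩ := h
  refine ⟨β₃, fun b hb => ?_⟩
  have hd := hβ₃ b hb
  rw [Real.dist_eq] at hd
  have h2 := abs_lt.1 hd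
  constructor <;> linarith [h2.1, h2.2]

/-- ★★ **THE FIXED-`L` RELATIVE GAP IN LIMIT FORM**: if, at `L`, the principal σ-sector small-ball LIMIT holds (`v > 0`) AND the periodic ring's
mean action obeys the sharp softness in limit form (for every `ε > 0`, eventually `β·(log Z)′(β) ≥ 12βL⁴ − 9L⁴ + 3/2 − ε` — at fixed `L` a
consequence of ✓`toronSoftnessSharp_of_toronTubeVolumeLaw` under ⟨24497⟩), then for every `ε > 0`, eventually
`β·(log Z^S)′(β) − β·(log Z)′(β) ≤ −(1/2 − 2ε)`: the σ-glued ring is stiffer by any amount below `1/2` (prediction `1/2 + 1/log β`,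
instrument j320281: `0.483 ± 0.038`). [cite: Griffiths1964] [cite: tHooft1979] [cite: Luscher1983, §2] -/
theorem swap_meanActionGap_fixedL_of_limits (L : ℕ) [NeZero L] {v : ℝ} (hv : 0 < v)
    (hlim : Tendsto (fun s : ℝ => (ringMeasure L).real {P | swapRingDeficit L (fun _ => false) P ≤ s} / s ^ (9 * L ^ 4 - 1))
      (𝓝[>] 0) (𝓝 v))
    (hper : ∀ ε : ℝ, 0 < ε → ∃ β₀ : ℝ, ∀ b : ℝ, β₀ ≤ b →
      12 * b * (L : ℝ) ^ 4 - 9 * (L : ℝ) ^ 4 + 3 / 2 - ε ≤ b * deriv (fun x : ℝ => Real.log (TT.physTrace L x (2 * L))) b)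
    {ε : ℝ} (hε : 0 < ε) :
    ∃ β₀ : ℝ, ∀ b : ℝ, β₀ ≤ b →
      b * deriv (fun x : ℝ => Real.log (TT.twistTrace L x (2 * L))) b -
          b * deriv (fun x : ℝ => Real.log (TT.physTrace L x (2 * L))) b ≤ -(1 / 2 - 2 * ε) := by
  obtain ⟨β₃, hβ₃⟩ := swap_stiffness_fixedL_of_principalLimit L hv hlim hε
  obtain ⟨βp, hβp⟩ := hper ε hε
  refine ⟨max β₃ βp, fun b hb => ?_⟩
  have hS := (hβ₃ b (le_trans (le_max_left _ _) hb)).1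
  have hP := hβp b (le_trans (le_max_right _ _) hb)
  linarith

end Summit.QuantumFields.YangMills.Theorems.SwapVirialDeficit.SwapRing

end
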